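import Summits.QuantumFields.GaugeBoot.StrongCouplingPlaquetteSUNThirdLimit
import Summits.QuantumFields.GaugeBoot.StrongCouplingPlaquetteSU3ThirdLimit
import Summits.QuantumFields.GaugeBoot.StrongCouplingPlaquetteSU2Third
import HarnessLib

/-!
# Strong coupling from the loop equation: THE FIRST TWO STRONG-COUPLING COEFFICIENTS OF THE `SU(N)` PLAQUETTE FOR EVERY `N ≥ 2` (gauge-boot, ADDENDUM 25 part H)

HONEST FRAMING (cell `pub-gaugeboot`, page 1 of every file): the venture produces certified bounds
on lattice expectations at stated coupling, gauge group, dimension and torus size; NOT a mass gap,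
NOT a continuum limit, NOT a string tension; NOT Yang–Mills-summit-bearing (barriers
`FixedCouplingUltralocality`, `PerturbativeInvisibility`).  Analytic STRONG-COUPLING bounds with crude explicit
constants, uniform in the volume; informative only for small `β_std`; no number of CERTIFIED.md is touched.

## Content

One statement for all gauge groups `SU(N)`, `N ≥ 2`, all dimensions `D ≥ 2`, all torus sides `L ≥ 2` and all real
couplings `β_std` (ADDENDUM 24: `SU(2)`, `SU(3)`; ADDENDUM 25: `SU(N ≥ 4)`):

* ★★★ `abs_plaquetteExpectation_secondOrder_le` —
  **`|plaquetteExpectation N D L β − c₁(N)·β − c₂(N)·β²| ≤ (5/2)·D²(D−1)·|β|³`** with the strong-coupling coefficients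
  `c₁(2) = 1/4`, `c₁(N) = 1/(2N²)` (`N ≥ 3`) and `c₂(3) = 1/216`, `c₂(N) = 0` (`N ≠ 3`) — written with `if`s, no new
  definition.  The `β²` coefficient of the lattice `SU(N)` plaquette is the `SU(3)` baryon vertex and nothing else.
* ★★★ `abs_integral_plaquette_secondOrder_le_of_mem_limitPoints` — the same at every infinite-volume limit point of the
  torus Wilson states on `ℤ^D`.

What is NOT here: `U(N)` (`c₂ = 0` for `N ≥ 3`, same proof with `s = 0`, not written), the third coefficient
(`SU(2)`: `−1/96`; needs the fourth loop-equation step AND `L ≥ 3` — on the side-2 torus the plaquette plane is a closed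
surface of area 4, which contributes at order `β³`), DLR states outside the Dobrushin window.

References: R. Balian, J.-M. Drouffe, C. Itzykson, Phys. Rev. D 11 (1975) 2104; M. Creutz, *Quarks, gluons and lattices*
(1983) Ch. 8 (one-link integrals: `∫ exp tr(Jg) dg` is a function of `det J`); J.-M. Drouffe, J.-B. Zuber, Phys. Rept. 102
(1983).  Everything is `[folklore]`.
-/

noncomputable section

open MeasureTheory Filter Topology
open Literature.MathematicalPhysics.QuantumFieldTheory
open Literature.MathematicalPhysics.QuantumLattice (LGConfig plaquetteObs infiniteVolumeLimitPoints ymGibbsMeasures)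

namespace Summit.QuantumFields.GaugeBoot

namespace StrongCoupling

/-- ★★★ **THE STRONG-COUPLING EXPANSION OF THE `SU(N)` PLAQUETTE THROUGH SECOND ORDER, EVERY `N ≥ 2`.**  For `D ≥ 2`, every
torus side `L ≥ 2` and every real `β_std`:
`|plaquetteExpectation N D L β − c₁(N)β − c₂(N)β²| ≤ (5/2)D²(D−1)|β|³`, where `c₁(2) = 1/4`, `c₁(N) = 1/(2N²)` for `N ≥ 3`,
`c₂(3) = 1/216` and `c₂(N) = 0` for `N ≠ 3`.  (`SU(2)`: ADDENDUM 24 part I; `SU(3)`: ADDENDUM 24; `SU(N ≥ 4)`: ADDENDUM 25.)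
[folklore] -/
theorem abs_plaquetteExpectation_secondOrder_le {N D L : ℕ} [NeZero L] (hN : 2 ≤ N) (hL : 2 ≤ L) (hD : 2 ≤ D) (β : ℝ) :
    |plaquetteExpectation N D L β - (if N = 2 then β / 4 else β / (2 * (N : ℝ) ^ 2)) -
        (if N = 3 then β ^ 2 / 216 else 0)| ≤ 5 / 2 * (D : ℝ) ^ 2 * ((D : ℝ) - 1) * |β| ^ 3 := by
  have hD2 : (2 : ℝ) ≤ D := by exact_mod_cast hD
  have hK : 0 ≤ (D : ℝ) ^ 2 * ((D : ℝ) - 1) * |β| ^ 3 := by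
    have : 0 ≤ (D : ℝ) - 1 := by linarith
    positivity
  rcases Nat.lt_or_ge N 4 with hlt | hge
  · interval_cases N
    · -- `SU(2)`
      simp only [if_true, show (2 : ℕ) ≠ 3 by decide, if_false, sub_zero]
      exact abs_plaquetteExpectation_two_third_le hL hD β
    · -- `SU(3)`
      simp only [show (3 : ℕ) ≠ 2 by decide, if_false, if_true, Nat.cast_ofNat]
      have h := abs_plaquetteExpectation_su3_third_le (D := D) (L := L) hL hD β
      rw [show β / (2 * (3 : ℝ) ^ 2) = β / 18 by norm_num]
      linarith
  · -- `SU(N)`, `N ≥ 4`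
    have hN4 : (4 : ℝ) ≤ N := by exact_mod_cast hge
    simp only [show N ≠ 2 by omega, show N ≠ 3 by omega, if_false, sub_zero]
    have h := abs_plaquetteExpectation_suN_third_le (N := N) (D := D) (L := L) hge hL hD β
    refine h.trans ?_
    rw [div_le_iff₀ (by positivity)]
    have hN1 : (1 : ℝ) ≤ (N : ℝ) ^ 2 := by nlinarith
    nlinarith [mul_le_mul_of_nonneg_left hN1 hK]

/-- ★★★ **The same at every infinite-volume limit point**: for `N ≥ 2`, `D ≥ 2`, every real `β_std`, every
`μ ∈ infiniteVolumeLimitPoints (suRep N) (β_std/N)` and every plaquette of `ℤ^D`: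
`|∫ (1/N)Re tr U_P dμ − c₁(N)β − c₂(N)β²| ≤ (5/2)D²(D−1)|β|³`. [folklore] -/
theorem abs_integral_plaquette_secondOrder_le_of_mem_limitPoints {N D : ℕ} (hN : 2 ≤ N) (hD : 2 ≤ D) (β : ℝ)
    {μ : Measure (LGConfig D (SU N))} (hμ : μ ∈ infiniteVolumeLimitPoints (d := D) (suRep N) (β / N))
    (x : Literature.Probability.LatticeModels.Site D) {i j : Fin D} (hij : i ≠ j) :
    |∫ U, (N : ℝ)⁻¹ * plaquetteObs (suRep N) x i j U ∂μ - (if N = 2 then β / 4 else β / (2 * (N : ℝ) ^ 2)) -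
        (if N = 3 then β ^ 2 / 216 else 0)| ≤ 5 / 2 * (D : ℝ) ^ 2 * ((D : ℝ) - 1) * |β| ^ 3 := by
  have h := abs_integral_plaquette_sub_le_of_forall (N := N) (D := D)
    (c := (if N = 2 then β / 4 else β / (2 * (N : ℝ) ^ 2)) + (if N = 3 then β ^ 2 / 216 else 0))
    (K := 5 / 2 * (D : ℝ) ^ 2 * ((D : ℝ) - 1) * |β| ^ 3) (by omega)
    (fun L _ hL => by rw [← sub_sub]; exact abs_plaquetteExpectation_secondOrder_le hN hL hD β) hμ x hij
  rw [← sub_sub] at h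
  exact h

/-- ★★★ **… and for every DLR state in the uniqueness window** `6(D−1)|β_std| < 1`. [folklore] -/
theorem abs_integral_plaquette_secondOrder_le_of_mem_ymGibbsMeasures {N D : ℕ} (hN : 2 ≤ N) (hD : 2 ≤ D) {β : ℝ}
    (hβ : 6 * ((D : ℝ) - 1) * |β| < 1) {μ : Measure (LGConfig D (SU N))} (hμ : μ ∈ ymGibbsMeasures (d := D) (suRep N) (β / N))
    (x : Literature.Probability.LatticeModels.Site D) {i j : Fin D} (hij : i ≠ j) :
    |∫ U, (N : ℝ)⁻¹ * plaquetteObs (suRep N) x i j U ∂μ - (if N = 2 then β / 4 else β / (2 * (N : ℝ) ^ 2)) -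
        (if N = 3 then β ^ 2 / 216 else 0)| ≤ 5 / 2 * (D : ℝ) ^ 2 * ((D : ℝ) - 1) * |β| ^ 3 :=
  abs_integral_plaquette_secondOrder_le_of_mem_limitPoints hN hD β
    (mem_limitPoints_of_mem_ymGibbsMeasures_of_small (N := N) (D := D) (by omega) (by omega) hβ hμ) x hij

end StrongCoupling

end Summit.QuantumFields.GaugeBoot

end
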